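import Mathlib.Probability.Independence.Basic
import Mathlib.MeasureTheory.Measure.Real
import Mathlib.Analysis.Complex.Exponential
import HarnessLib

/-!
# Many successes among independent trials, by blocks (the repetition count of Micciancio–Regev 2007, Thm. 5.23)

Topic `Probability/Moments`. A fully PROVED elementary lower-tail bound for the number of successes
among independent, NOT identically distributed trials, in the form used by Micciancio–Regev
(*Worst-case to average-case reductions based on Gaussian measures*, SIAM J. Comput. 37 (2007),
proof of Thm. 5.23, authors' version pp. 29–30): the procedure `W` is applied `n · N/δ` times with
independent randomness, each run succeeding with probability at least `δ/2`, and "the probability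
that out of `n · N/δ` calls to `W` less than `N` are successful is at most
`N(1 - δ/2)^{n/δ} ≤ N e^{-n/2}`". The argument is the block argument: split the `N · k` trials into
`N` blocks of `k` consecutive trials; if fewer than `N` trials succeed, some block has no success, and a
fixed block has no success with probability `∏ⱼ (1 - pⱼ) ≤ (1 - p)^k`.

* `measureReal_forall_eq_false_le` — for independent Boolean trials `X_{b,j}` with
  `Pr[X_{b,j}] ≥ p`, a fixed block `b` has no success with probability `≤ (1 - p)^k`.
* `MicciancioRegev2007.measureReal_card_successes_lt_le` — **the printed bound**: the probability that
  fewer than `N` of the `N · k` trials succeed is at most `N (1 - p)^k`.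
* `MicciancioRegev2007.one_sub_half_pow_le_exp` — `(1 - δ/2)^k ≤ e^{-n/2}` once `k ≥ n/δ`
  (`1 - x ≤ e^{-x}`), the second printed step.

Mathlib only (`iIndepFun.meas_biInter`, `Real.one_sub_le_exp_neg`); written for the decomposition of
`Literature.Computability.Cryptography.MicciancioRegev2007_gapCVP'_to_SIS'`.

## References

* D. Micciancio, O. Regev, *Worst-case to average-case reductions based on Gaussian measures*,
  SIAM J. Comput. 37 (2007) 267–302; authors' version, proof of Thm. 5.23, pp. 29–30
  (`lit read doi:10.1137/S0097539705447360`).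
-/

noncomputable section

open MeasureTheory ProbabilityTheory Finset

namespace Literature.Probability.Moments

variable {Ω : Type*} [MeasurableSpace Ω] {P : Measure Ω} [IsProbabilityMeasure P]
variable {N k : ℕ}

/-- **A block of independent trials has no success with probability `≤ (1 - p)^k`**: for independent
Boolean random variables `X_{b,j}` (`b < N`, `j < k`) with `Pr[X_{b,j} = true] ≥ p`, and a fixed
block `b`, `Pr[∀ j, X_{b,j} = false] ≤ (1 - p)^k` (independence gives the product of the
`Pr[X_{b,j} = false] = 1 - Pr[X_{b,j} = true] ≤ 1 - p`). [cite: MicciancioRegev2007, Thm. 5.23 (proof, p. 30)] -/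
theorem measureReal_forall_eq_false_le {X : Fin N × Fin k → Ω → Bool} (hind : iIndepFun X P)
    (hmeas : ∀ i, Measurable (X i)) {p : ℝ}
    (hp : ∀ i, p ≤ P.real {ω | X i ω = true}) (b : Fin N) :
    P.real {ω | ∀ j, X (b, j) ω = false} ≤ (1 - p) ^ k := by
  classical
  -- the block event as an intersection over the index set `{b} × univ`
  set S : Finset (Fin N × Fin k) := Finset.univ.filter fun i => i.1 = b with hS
  have hset : {ω | ∀ j, X (b, j) ω = false} = ⋂ i ∈ S, {ω | X i ω = false} := by
    ext ω
    simp only [Set.mem_setOf_eq, Set.mem_iInter, hS, Finset.mem_filter, Finset.mem_univ, true_and]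
    constructor
    · rintro h ⟨b', j⟩ (rfl : b' = b)
      exact h j
    · intro h j
      exact h (b, j) rfl
  have hcomap : ∀ i, i ∈ S → MeasurableSet[MeasurableSpace.comap (X i) inferInstance] {ω | X i ω = false} :=
    fun i _ => ⟨{false}, trivial, rfl⟩
  have hprod : P (⋂ i ∈ S, {ω | X i ω = false}) = ∏ i ∈ S, P {ω | X i ω = false} :=
    hind.meas_biInter hcomap
  have hreal : P.real (⋂ i ∈ S, {ω | X i ω = false}) = ∏ i ∈ S, P.real {ω | X i ω = false} := by
    rw [measureReal_def, hprod, ENNReal.toReal_prod]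
    rfl
  -- each factor is `1 - Pr[X i = true] ≤ 1 - p`
  have hfac : ∀ i, P.real {ω | X i ω = false} ≤ 1 - p := fun i => by
    have hm : MeasurableSet {ω | X i ω = true} := hmeas i (measurableSet_singleton true)
    have hcompl : {ω | X i ω = false} = {ω | X i ω = true}ᶜ := by
      ext ω
      simp
    rw [hcompl, measureReal_compl hm, probReal_univ]
    linarith [hp i]
  have hcard : S.card = k := by
    rw [hS]
    have : (Finset.univ.filter fun i : Fin N × Fin k => i.1 = b) =
        (({b} : Finset (Fin N)) ×ˢ (Finset.univ : Finset (Fin k))) := by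
      ext ⟨b', j⟩
      simp [eq_comm]
    rw [this, Finset.card_product, Finset.card_singleton, Finset.card_univ, Fintype.card_fin, one_mul]
  rw [hset, hreal]
  calc ∏ i ∈ S, P.real {ω | X i ω = false} ≤ ∏ _i ∈ S, (1 - p) :=
        Finset.prod_le_prod (fun i _ => measureReal_nonneg) fun i _ => hfac i
    _ = (1 - p) ^ k := by rw [Finset.prod_const, hcard]

/-- **Micciancio–Regev 2007, proof of Thm. 5.23, the repetition bound** (p. 30: "the probability
that out of `n · N/δ` calls to `W` less than `N` are successful is at most `N(1 - δ/2)^{n/δ}`"): for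
`N · k` independent Boolean trials `X_{b,j}` (`b < N`, `j < k`; not necessarily identically
distributed) with `Pr[X_{b,j} = true] ≥ p`, the probability that fewer than `N` trials succeed is
at most `N (1 - p)^k` — if every one of the `N` blocks contains a success there are at least `N`
successes, and a block has none with probability `≤ (1 - p)^k` (`measureReal_forall_eq_false_le`).
[cite: MicciancioRegev2007, Thm. 5.23 (proof, p. 30)] -/
theorem MicciancioRegev2007.measureReal_card_successes_lt_le {X : Fin N × Fin k → Ω → Bool}
    (hind : iIndepFun X P) (hmeas : ∀ i, Measurable (X i)) {p : ℝ}
    (hp : ∀ i, p ≤ P.real {ω | X i ω = true}) :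
    P.real {ω | (Finset.univ.filter fun i => X i ω = true).card < N} ≤ N * (1 - p) ^ k := by
  classical
  have hsub : {ω | (Finset.univ.filter fun i => X i ω = true).card < N} ⊆
      ⋃ b : Fin N, {ω | ∀ j, X (b, j) ω = false} := by
    intro ω hω
    by_contra hcon
    simp only [Set.mem_iUnion, Set.mem_setOf_eq, not_exists, not_forall] at hcon
    -- every block has a success: pick one per block, injectively
    choose j hj using hcon
    have hinj : Function.Injective fun b : Fin N => ((b, j b) : Fin N × Fin k) :=
      fun b b' h => (Prod.ext_iff.1 h).1
    have hle : N ≤ (Finset.univ.filter fun i => X i ω = true).card := by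
      calc N = (Finset.univ.image fun b : Fin N => ((b, j b) : Fin N × Fin k)).card := by
            rw [Finset.card_image_of_injective _ hinj, Finset.card_univ, Fintype.card_fin]
        _ ≤ (Finset.univ.filter fun i => X i ω = true).card := by
            refine Finset.card_le_card fun i hi => ?_
            simp only [Finset.mem_image, Finset.mem_univ, true_and] at hi
            obtain ⟨b, rfl⟩ := hi
            simp only [Finset.mem_filter, Finset.mem_univ, true_and]
            have := hj b
            simpa using this
    exact absurd hω (not_lt.2 hle)
  calc P.real _ ≤ P.real (⋃ b : Fin N, {ω | ∀ j, X (b, j) ω = false}) := measureReal_mono hsub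
    _ ≤ ∑ b : Fin N, P.real {ω | ∀ j, X (b, j) ω = false} := measureReal_iUnion_fintype_le _
    _ ≤ ∑ _b : Fin N, (1 - p) ^ k :=
        Finset.sum_le_sum fun b _ => measureReal_forall_eq_false_le hind hmeas hp b
    _ = N * (1 - p) ^ k := by
        rw [Finset.sum_const, Finset.card_univ, Fintype.card_fin, nsmul_eq_mul]

/-- **The second printed step** (p. 30: "`N(1 - δ/2)^{n/δ} ≤ N e^{-n/2}`"): for `0 < δ ≤ 2` and an
integer block length `k ≥ n/δ`, `(1 - δ/2)^k ≤ e^{-n/2}` (from `1 - x ≤ e^{-x}`).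
[cite: MicciancioRegev2007, Thm. 5.23 (proof, p. 30)] -/
theorem MicciancioRegev2007.one_sub_half_pow_le_exp {δ x : ℝ} (hδ : 0 < δ) (hδ2 : δ ≤ 2) {k : ℕ}
    (hk : x / δ ≤ k) : (1 - δ / 2) ^ k ≤ Real.exp (-(x / 2)) := by
  have h1 : (1 - δ / 2) ^ k ≤ Real.exp (-(δ / 2)) ^ k :=
    pow_le_pow_left₀ (by linarith) (Real.one_sub_le_exp_neg _) k
  refine h1.trans ?_
  rw [← Real.exp_nat_mul, Real.exp_le_exp]
  have : x ≤ k * δ := by rwa [div_le_iff₀ hδ] at hk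
  nlinarith

end Literature.Probability.Moments

end
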